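import Literature.AlgebraicGeometry.Hu2025.Proofs.S04ModelV.RootParents
import Literature.AlgebraicGeometry.Hu2025.Proofs.S04ModelV.GoverningPlatform
import HarnessLib

/-!
# Hu 2025 §4.2.2, the remark after Ex. 4.14 ‹chunk 4.13› «It is not hard to see that a ℘-binomial does not admit any
# non-zero root parent» (`C23L47` / `C23L47_R2`) AT THE PLATFORM `Gr^{3,6}`, `p_{(123)} ≡ 1` (`relN 6`, `monoN 6`,
# `Φ = univ`): a NON-ZERO ROOT PARENT of a ℘-binomial, under BOTH typed readings (file
# `Proofs/S04ModelV/RootParentsPlatformSix.lean`; typer of record res-type-042, row 103; companion of `RootParents.lean`)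

**HONEST FRAMING (D-0012/D-0089).** A kernel fact about OUR typed renderings of row 103 (`IsRootParentOf` = reading R1,
res-type-044, arbitrary cofactors; `IsRootParentOfR2` = reading R2, res-type-042, term-wise expressions in `R_[k]`)
instantiated at the row-101/102/105 platform data of res-type-009 / res-type-079 (`primaryTerms`, `relN`, `monoN`). It
says that AS TYPED — with «parent» generated by the printed one-step rule of Def. 4.11 applied to expressions that may
cancel, as the printed Ex. 4.14 does — the remark p.50 L027 fails on the platform `n = 6`; whether the text intends a
narrower class of expressions is a question for the lanes / res-adj (READING NOTE in `RootParents.lean`), not decided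
here. The preprint [Hu2025] (arXiv:2507.21400v1) stays «under review»; nothing of it is asserted; AI proof is weaker than
expert review; nothing here is progress on resolution of singularities.

THE WITNESS (display (3.13)/(3.12) at `n = 6`: `F̄_{(123),(456)} = x_{456} − x_{124}x_{356} + x_{134}x_{256} − x_{234}x_{156}`,
`F̄_{(123),(356)} = x_{356} − x_{135}x_{236} + x_{235}x_{136}`). Terms: `i = s_F` (`x̄_i = x_{456}`), `j` = the term
`x_{124}x_{356}` of `F = F̄_{(456)}`; `g₀ = s_G` (`x̄_{g₀} = x_{356}`), `g₁` = the term `x_{135}x_{236}` of `G = F̄_{(356)}`.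
`B_F = x_{124}x_{356}·x_{(i)} − x_{456}·x_{(j)}` (a ℘-binomial of `ℙ_F`), `B_G = x_{135}x_{236}·x_{(g₀)} − x_{356}·x_{(g₁)}`,
`f_R = x_{(g₀)} x_{(i)} B_F + x_{(i)}² B_G` (four monomials). `f_R →_G x_{356} x_{(i)} B_F →_F B_F` by two cancelling
term-wise expressions (`RootParents.isParentOfR2_rootWitness`); nothing descends to `f_R` at any block: its monomial
`x_{(g₀)}x_{(i)}x_{(j)}·x_{456}` forces the block `F̄_{(456)}` (no other chart monomial divides `x_{456}`), and its monomial
`x_{(i)}²x_{(g₀)}·x_{135}x_{236}` is divisible by none of `x_{456}`, `x_{124}x_{356}`, `x_{134}x_{256}`, `x_{234}x_{156}`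
(kernel: the two evaluations `ψ_A`, `ψ_B` of `RootParents.not_isDescentStep_rootWitness`, fed with three `decide`d facts
about the 31 terms of the 10 primary relations of `Gr^{3,6}`).
-/

noncomputable section

namespace Literature.AlgebraicGeometry.Hu2025.Proofs.S04ModelV

open MvPolynomial Literature.AlgebraicGeometry.Hu2025.Statements.S03Pluecker
  Literature.AlgebraicGeometry.Hu2025.Statements.S04ModelV

/-- The 31 terms of the ten primary relations of `Gr^{3,6}`: every first index triple `u_s` is a Plücker VARIABLE index
(`≠ (123)`, in `𝕀_{3,6}`). [cite: Hu2025, §3 (3.10)–(3.13) at n = 6, chunk p0018 l.17–33, p.37 (unrefereed preprint arXiv:2507.21400v1 under adjudication, D-0012/D-0089 — kernel bookkeeping on OUR typed carriers of rows 101/105; nothing of the source asserted)] -/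
theorem termN_us_mem_plVarSet_six : ∀ h : TermIdx 6, (termN h).us ∈ plVarSet 6 := by
  decide

/-- At `Gr^{3,6}`, `x_{456}` is the first index of no term outside the block `F̄_{(123),(456)}`.
[cite: Hu2025, §3 (3.10)–(3.13) at n = 6, chunk p0018 l.17–33, p.37 (unrefereed preprint arXiv:2507.21400v1 under adjudication, D-0012/D-0089 — kernel bookkeeping on OUR typed carriers of rows 101/105; nothing of the source asserted)] -/
theorem termN_us_ne_456_six : ∀ h : TermIdx 6,
    relN 6 h ≠ (⟨⟨(4, 5, 6), by decide⟩, by decide⟩ : RelIdx 6) → (termN h).us ≠ (4, 5, 6) := by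
  decide

/-- At `Gr^{3,6}`, the first indices of the four terms of `F̄_{(123),(456)}` (`(456), (124), (134), (234)`) avoid
`{(135), (236), (356)}`. [cite: Hu2025, §3 (3.13) at n = 6, chunk p0018 l.30–33, p.37 (unrefereed preprint arXiv:2507.21400v1 under adjudication, D-0012/D-0089 — kernel bookkeeping on OUR typed carriers of rows 101/105; nothing of the source asserted)] -/
theorem termN_us_F456_six : ∀ h : TermIdx 6,
    relN 6 h = (⟨⟨(4, 5, 6), by decide⟩, by decide⟩ : RelIdx 6) →
      (termN h).us ≠ (1, 3, 5) ∧ (termN h).us ≠ (2, 3, 6) ∧ (termN h).us ≠ (3, 5, 6) := by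
  decide

/-- The first index `u_s` of every term occurs in its chart monomial `x̄_{u_s} x̄_{v_s}` (at `Gr^{3,6}`).
[cite: Hu2025, §3 (3.15) / §4.1 (4.7), chunks p0018 l.48–51 / p0021 l.122–132, pp. 38, 46 (unrefereed preprint arXiv:2507.21400v1 under adjudication, D-0012/D-0089 — kernel bookkeeping on OUR typed carriers of rows 101/105; nothing of the source asserted)] -/
theorem us_mem_support_monoN_six (h : TermIdx 6) :
    (⟨(termN h).us, termN_us_mem_plVarSet_six h⟩ : plVar 6) ∈ (monoN 6 h).support := by
  rw [Finsupp.mem_support_iff, monoN, Finsupp.add_apply]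
  unfold plExp
  rw [dif_pos (termN_us_mem_plVarSet_six h), Finsupp.single_eq_same]
  omega

/-- **A NON-ZERO ROOT PARENT OF A ℘-BINOMIAL AT THE PLATFORM `Gr^{3,6}`** (`Φ = univ`, every nontrivial commutative
coefficient ring), under BOTH readings: with `i = s_{(456)}`, `j` = the term `x_{124}x_{356}` of `F̄_{(123),(456)}`,
`g₀ = s_{(356)}`, `g₁` = the term `x_{135}x_{236}` of `F̄_{(123),(356)}`, the ℘-binomial `B_F = x̄_j x_{(i)} − x̄_i x_{(j)}`
lies in `B^℘`, and `f_R = x_{(g₀)} x_{(i)} B_F + x_{(i)}² (x̄_{g₁} x_{(g₀)} − x̄_{g₀} x_{(g₁)}) ≠ 0` is a root parent of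
`B_F` (`IsRootParentOf`) and a term-wise root parent of `B_F` (`IsRootParentOfR2 univ`).
[cite: Hu2025, §4.2.2 remark after Ex. 4.14 ‹chunk 4.13› «a ℘-binomial does not admit any non-zero root parent», chunk p0023 l.47–48, p.50 L027; §3 (3.12)/(3.13) at n = 6 (unrefereed preprint arXiv:2507.21400v1 under adjudication, D-0012/D-0089 — kernel countermodel to OUR typed renderings `C23L47`/`C23L47_R2` of row 103 at the platform instantiation; nothing of the source asserted)] -/
theorem rootParent_platform_six (k : Type) [CommRing k] [Nontrivial k] :
    let F456 : RelIdx 6 := ⟨⟨(4, 5, 6), by decide⟩, by decide⟩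
    let F356 : RelIdx 6 := ⟨⟨(3, 5, 6), by decide⟩, by decide⟩
    let i : TermIdx 6 := headN 6 F456
    let j : TermIdx 6 := ⟨F456, ⟨1, by decide⟩⟩
    let g₀ : TermIdx 6 := headN 6 F356
    let g₁ : TermIdx 6 := ⟨F356, ⟨1, by decide⟩⟩
    wpBinomial (k := k) (σ := plVar 6) (monoN 6) i j ∈ wpBinomials (k := k) (relN 6) (monoN 6) Set.univ ∧
    (rhoVar (k := k) (σ := plVar 6) g₀ * rhoVar (k := k) (σ := plVar 6) i * wpBinomial (k := k) (σ := plVar 6) (monoN 6) i j +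
        rhoVar (k := k) (σ := plVar 6) i * rhoVar (k := k) (σ := plVar 6) i *
          wpBinomial (k := k) (σ := plVar 6) (monoN 6) g₀ g₁) ≠ 0 ∧
    IsRootParentOf (k := k) (relN 6) (monoN 6)
      (rhoVar (k := k) (σ := plVar 6) g₀ * rhoVar (k := k) (σ := plVar 6) i * wpBinomial (k := k) (σ := plVar 6) (monoN 6) i j +
        rhoVar (k := k) (σ := plVar 6) i * rhoVar (k := k) (σ := plVar 6) i *
          wpBinomial (k := k) (σ := plVar 6) (monoN 6) g₀ g₁)
      (wpBinomial (k := k) (σ := plVar 6) (monoN 6) i j) ∧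
    IsRootParentOfR2 (k := k) (relN 6) (monoN 6) Set.univ
      (rhoVar (k := k) (σ := plVar 6) g₀ * rhoVar (k := k) (σ := plVar 6) i * wpBinomial (k := k) (σ := plVar 6) (monoN 6) i j +
        rhoVar (k := k) (σ := plVar 6) i * rhoVar (k := k) (σ := plVar 6) i *
          wpBinomial (k := k) (σ := plVar 6) (monoN 6) g₀ g₁)
      (wpBinomial (k := k) (σ := plVar 6) (monoN 6) i j) := by
  classical
  intro F456 F356 i j g₀ g₁
  -- the term data, read off `primaryTerms (4,5,6)` / `primaryTerms (3,5,6)`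
  have hj_us : (termN j).us = (1, 2, 4) := by decide
  have hj_vs : (termN j).vs = (3, 5, 6) := by decide
  have hg₁_us : (termN g₁).us = (1, 3, 5) := by decide
  have hg₁_vs : (termN g₁).vs = (2, 3, 6) := by decide
  have hmi : monoN 6 i = Finsupp.single (⟨(4, 5, 6), by decide⟩ : plVar 6) 1 := monoN_headN 6 F456
  have hmg₀ : monoN 6 g₀ = Finsupp.single (⟨(3, 5, 6), by decide⟩ : plVar 6) 1 := monoN_headN 6 F356
  have hmj : monoN 6 j = Finsupp.single (⟨(1, 2, 4), by decide⟩ : plVar 6) 1 +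
      Finsupp.single (⟨(3, 5, 6), by decide⟩ : plVar 6) 1 := by
    rw [monoN, hj_us, hj_vs]
    unfold plExp
    rw [dif_pos (by decide), dif_pos (by decide)]
  have hmg₁ : monoN 6 g₁ = Finsupp.single (⟨(1, 3, 5), by decide⟩ : plVar 6) 1 +
      Finsupp.single (⟨(2, 3, 6), by decide⟩ : plVar 6) 1 := by
    rw [monoN, hg₁_us, hg₁_vs]
    unfold plExp
    rw [dif_pos (by decide), dif_pos (by decide)]
  have HA : ∀ h : TermIdx 6, relN 6 h ≠ relN 6 i →
      ∃ s ∈ (monoN 6 h).support, s ≠ (⟨(4, 5, 6), by decide⟩ : plVar 6) := by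
    intro h hh
    refine ⟨_, us_mem_support_monoN_six h, fun e => ?_⟩
    exact termN_us_ne_456_six h hh (congrArg Subtype.val e)
  have HB : ∀ h : TermIdx 6, relN 6 h = relN 6 i →
      ∃ s ∈ (monoN 6 h).support, s ≠ (⟨(1, 3, 5), by decide⟩ : plVar 6) ∧
        s ≠ (⟨(2, 3, 6), by decide⟩ : plVar 6) ∧ s ≠ (⟨(3, 5, 6), by decide⟩ : plVar 6) := by
    intro h hh
    obtain ⟨h1, h2, h3⟩ := termN_us_F456_six h hh
    exact ⟨_, us_mem_support_monoN_six h, fun e => h1 (congrArg Subtype.val e), fun e => h2 (congrArg Subtype.val e),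
      fun e => h3 (congrArg Subtype.val e)⟩
  exact rootWitness_spec (k := k) (relN 6) (monoN 6) Set.univ (i := i) (j := j) (g₀ := g₀) (g₁ := g₁) rfl rfl
    (Set.mem_univ _) (Set.mem_univ _) (by decide) (by decide) (by decide) hmi hmj hmg₀ hmg₁ (by decide) (by decide)
    (by decide) (by decide) (by decide) (by decide) HA HB

/-- **`¬ C23L47` and `¬ C23L47_R2` AT THE PLATFORM `Gr^{3,6}`** (`relN 6`, `monoN 6`, `Φ = univ`; every nontrivial
commutative coefficient ring): the typed remark «a ℘-binomial does not admit any non-zero root parent» fails there AS TYPED,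
in reading R1 (res-type-044's parents, arbitrary cofactors) and in reading R2 (term-wise parents in `R_[Υ] = R`).
[cite: Hu2025, §4.2.2 remark after Ex. 4.14 ‹chunk 4.13› «a ℘-binomial does not admit any non-zero root parent», chunk p0023 l.47–48, p.50 L027; §3 (3.12)/(3.13) at n = 6 (unrefereed preprint arXiv:2507.21400v1 under adjudication, D-0012/D-0089 — kernel countermodel to OUR typed renderings `C23L47`/`C23L47_R2` of row 103 at the platform instantiation; nothing of the source asserted)] -/
theorem not_C23L47_platform_six (k : Type) [CommRing k] [Nontrivial k] :
    ¬ C23L47 (k := k) (σ := plVar 6) (relN 6) (monoN 6) Set.univ ∧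
      ¬ C23L47_R2 (k := k) (σ := plVar 6) (relN 6) (monoN 6) Set.univ := by
  classical
  obtain ⟨hb, hne0, hroot, hrootR2⟩ := rootParent_platform_six k
  exact ⟨fun h => hne0 (h _ hb _ hroot), fun h => hne0 (h _ hb _ hrootR2)⟩

/-- **The universal closure of reading R1, `∀ data, C23L47`, is false** (instance: the platform `Gr^{3,6}` over `ℤ`).
[cite: Hu2025, §4.2.2 remark after Ex. 4.14 ‹chunk 4.13›, chunk p0023 l.47–48, p.50 L027 (unrefereed preprint arXiv:2507.21400v1 under adjudication, D-0012/D-0089 — kernel countermodel to OUR typed rendering `C23L47` of row 103; nothing of the source asserted)] -/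
theorem not_C23L47 :
    ¬ ∀ (k : Type) [CommRing k] (σ T 𝔗 : Type) [DecidableEq 𝔗] (rel : T → 𝔗) (mono : T → (σ →₀ ℕ))
        (Φ : Set 𝔗), C23L47 (k := k) (σ := σ) rel mono Φ :=
  fun h => (not_C23L47_platform_six ℤ).1 (h ℤ (plVar 6) (TermIdx 6) (RelIdx 6) (relN 6) (monoN 6) Set.univ)

/-- **The universal closure of reading R2, `∀ data, C23L47_R2`, is false** (instance: the platform `Gr^{3,6}` over `ℤ`).
[cite: Hu2025, §4.2.2 remark after Ex. 4.14 ‹chunk 4.13›, chunk p0023 l.47–48, p.50 L027 (unrefereed preprint arXiv:2507.21400v1 under adjudication, D-0012/D-0089 — kernel countermodel to OUR typed rendering `C23L47_R2` of row 103; nothing of the source asserted)] -/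
theorem not_C23L47_R2 :
    ¬ ∀ (k : Type) [CommRing k] (σ T 𝔗 : Type) [DecidableEq 𝔗] (rel : T → 𝔗) (mono : T → (σ →₀ ℕ))
        (Φ : Set 𝔗), C23L47_R2 (k := k) (σ := σ) rel mono Φ :=
  fun h => (not_C23L47_platform_six ℤ).2 (h ℤ (plVar 6) (TermIdx 6) (RelIdx 6) (relN 6) (monoN 6) Set.univ)

end Literature.AlgebraicGeometry.Hu2025.Proofs.S04ModelV

end
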